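import Mathlib.Analysis.SpecialFunctions.Log.NegMulLog
import Literature.Geometry.Riemannian.PerelmanEntropyCutoff
import HarnessLib

/-!
# The test-function upper bound for Perelman's `μ` (Perelman 2002, (3.1); Topping 2006, (8.1.8))

Stub `stub_muEntropyTestFunction` of line `ancient-sphere-rigidity` for the crux
`EntropyRung.SubcylindricalRecognition` (stmt-SmoothPoincare4-10869): on a closed Riemannian
manifold `(M, g)` with continuous scalar curvature `R` (w.r.t. a connection witness `cov`), for
`τ > 0` and every smooth `w : M → ℝ` with `Z = ∫ w² dV > 0`,

`μ(g, τ) ≤ Z⁻¹ ∫ [τ (R w² + 4 |∇w|²) - w² log w²] dV + log Z + log (4πτ)^{-n/2} - n`,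

the value of Perelman's `𝒲(g, f, τ)` at the (in general neither smooth nor admissible)
`f = -log (w²/Z) + log (4πτ)^{-n/2}`, i.e. `(4πτ)^{-n/2} e^{-f} = w²/Z` (Perelman 2002, (3.1)
in the variable `φ = e^{-f/2}`; Topping 2006, (8.1.8)). In dimension `4`,
`log (4πτ)^{-2} - 4 = -2 log (4πτ) - 4`, which is the registered signature.

## Proof

Exactly the smoothing device of `PerelmanEntropyCutoff.wEntropy_cutoffTest_le` /
`muEntropy_le_of_cutoff` (Topping 2006, proof of Lemma 8.3.5), with the cutoff `χ` replaced by a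
general smooth `w`:

* `wEntropy_logTestFunction_le` — for `δ > 0` put `v = w² + δ² > 0`, `N = ∫ v dV = Z + δ² Vol M`,
  `c = log ((4πτ)^{-n/2} N)` and `f = c - log v`. Then `f` is smooth, `(4πτ)^{-n/2} e^{-f} = v/N`
  is compatible, `|∇f|² = |∇v|²/v² = 4 w² |∇w|²/v²` (`gradSq_const_sub_log_comp`,
  `gradSq_sq_add_const`), and
  `𝒲(g, f, τ) = N⁻¹ ∫ [τ (R v + 4 w² |∇w|²/v) - v log v] dV + log N + log (4πτ)^{-n/2} - n
             ≤ N⁻¹ (τ (∫ R w² + δ² ∫ R) + 4τ ∫ |∇w|² - ∫ v log v) + log N + log (4πτ)^{-n/2} - n`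
  since `w²/v ≤ 1` and `|∇w|² ≥ 0` (`g` Riemannian);
* `muEntropy_le_testFunction` — `μ ≤ 𝒲(g, f_δ, τ)` (`muEntropy_le`) for every `δ > 0`, and the
  right-hand side is continuous in `δ` at `δ = 0` (`δ ↦ ∫ (w² + δ²) log (w² + δ²) dV` is a
  parametric integral of a jointly continuous integrand over a compact space with a finite
  measure, `continuous_parametric_integral_of_continuous`; `Z > 0`), with value the claimed
  bound at `δ = 0`;
* `stub_muEntropyTestFunction` — `n = finrank ℝ (EuclideanSpace ℝ (Fin 4)) = 4`.

## References

* G. Perelman, *The entropy formula for the Ricci flow and its geometric applications*,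
  arXiv:math/0211159 (2002), §3.1, (3.1) and the definition of `μ`. [Perelman2002]
* P. Topping, *Lectures on the Ricci flow*, LMS Lecture Note Series 325, CUP 2006, §8.1,
  (8.1.8); §8.3, proof of Lemma 8.3.5. [Topping2006]
-/

noncomputable section

open scoped Manifold ContDiff Topology ENNReal NNReal
open Set MeasureTheory Filter Module Literature.Geometry.Lorentzian Literature.Geometry.Riemannian

namespace Summit.SmoothPoincare4.SmoothPoincare4.Theorems.SubcylindricalRecognition.AncientSphereRigidity

section TestFunction

variable {E : Type*} [NormedAddCommGroup E] [NormedSpace ℝ E] [FiniteDimensional ℝ E]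
  {H : Type*} [TopologicalSpace H] {I : ModelWithCorners ℝ E H} [I.Boundaryless]
  {M : Type*} [TopologicalSpace M] [T2Space M] [CompactSpace M]
  [ChartedSpace H M] [IsManifold I ∞ M] [MeasurableSpace M] [BorelSpace M]

/-- **`𝒲` of the smoothed test functions `f = c - log (w² + δ²)`** (Topping 2006, proof of
Lemma 8.3.5 with a general smooth `w` in place of the cutoff; Perelman 2002, (3.1)). Let `g` be
Riemannian on a closed manifold with continuous scalar curvature `R` (w.r.t. `cov`), `τ > 0`,
`w` smooth with `∫ w² dV > 0`, `δ > 0`, `N = ∫ (w² + δ²) dV`, `c = log ((4πτ)^{-n/2} N)`. Then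
`f = c - log (w² + δ²)` is smooth and compatible, and
`𝒲(g, f, τ) ≤ N⁻¹ (τ (∫ R w² + δ² ∫ R) + 4τ ∫ |∇w|² - ∫ (w²+δ²) log (w²+δ²)) + log N
  + log (4πτ)^{-n/2} - n`
(`|∇f|² e^{-f} ∝ 4 w² |∇w|²/(w² + δ²) ≤ 4 |∇w|²`). [cite: Topping2006, §8.3, proof of Lemma 8.3.5] -/
theorem wEntropy_logTestFunction_le
    {g : PseudoRiemannianMetric I ∞ E (TangentSpace I : M → Type _)} (hg : g.IsRiemannian)
    {cov : CovariantDerivative I E (TangentSpace I : M → Type _)}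
    (hR : Continuous fun x ↦ g.scalarCurvatureWith cov x)
    {τ : ℝ} (hτ : 0 < τ) {w : M → ℝ} (hws : ContMDiff I 𝓘(ℝ, ℝ) ∞ w)
    (hZ : 0 < ∫ x, w x ^ 2 ∂g.riemVolume) {δ : ℝ} (hδ : 0 < δ) :
    let N : ℝ := ∫ x, (w x ^ 2 + δ ^ 2) ∂g.riemVolume
    let c : ℝ := Real.log ((4 * Real.pi * τ) ^ (-(finrank ℝ E : ℝ) / 2) * N)
    let f : M → ℝ := fun x ↦ c - Real.log (w x ^ 2 + δ ^ 2)
    ContMDiff I 𝓘(ℝ, ℝ) ∞ f ∧ g.IsEntropyCompatible f τ ∧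
      g.wEntropy cov f τ ≤
        (τ * ((∫ x, g.scalarCurvatureWith cov x * w x ^ 2 ∂g.riemVolume)
              + δ ^ 2 * ∫ x, g.scalarCurvatureWith cov x ∂g.riemVolume)
          + τ * (4 * ∫ x, g.gradSq w x ∂g.riemVolume)
          - ∫ x, (w x ^ 2 + δ ^ 2) * Real.log (w x ^ 2 + δ ^ 2) ∂g.riemVolume) / N
        + Real.log N + Real.log ((4 * Real.pi * τ) ^ (-(finrank ℝ E : ℝ) / 2)) - finrank ℝ E := by
  intro N c f
  classical
  set vol := g.riemVolume with hvol
  haveI : IsFiniteMeasure vol := ⟨g.riemVolume_univ_lt_top⟩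
  set n := finrank ℝ E with hn
  set A : ℝ := (4 * Real.pi * τ) ^ (-(n : ℝ) / 2) with hA
  have hApos : 0 < A := entropyNormalisation_pos n hτ
  set VM : ℝ := (vol univ).toReal with hVM
  have hVM0 : 0 ≤ VM := ENNReal.toReal_nonneg
  -- facts about `w`
  have hwc : Continuous w := hws.continuous
  have hwd : ∀ x, MDifferentiableAt I 𝓘(ℝ, ℝ) w x := fun x ↦
    (hws x).mdifferentiableAt (by simp)
  have hgrad_nn : ∀ x, 0 ≤ g.gradSq w x := g.gradSq_nonneg hg w
  have hgradc : Continuous (g.gradSq w) :=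
    continuous_innerDual_mvfderiv g (hws.of_le (by norm_num)) (hws.of_le (by norm_num))
  -- the positive function `v = w² + δ²`
  set v : M → ℝ := fun x ↦ w x ^ 2 + δ ^ 2 with hv
  have hvpos : ∀ x, 0 < v x := fun x ↦ by positivity
  have hvc : Continuous v := (hwc.pow 2).add continuous_const
  have hvs : ContMDiff I 𝓘(ℝ, ℝ) ∞ v :=
    ((hws.mul hws).add (contMDiff_const (c := δ ^ 2))).congr (fun x ↦ by
      simp only [hv, Pi.add_apply, Pi.mul_apply]; ring)
  have hvd : ∀ x, MDifferentiableAt I 𝓘(ℝ, ℝ) v x := fun x ↦ (hvs x).mdifferentiableAt (by simp)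
  -- `N = ∫ v = Z + δ² Vol M > 0`
  have hvi : Integrable v vol := g.integrable_of_continuous hvc
  have hw2i : Integrable (fun x ↦ w x ^ 2) vol := g.integrable_of_continuous (by fun_prop)
  have hNeq : N = (∫ x, w x ^ 2 ∂vol) + δ ^ 2 * VM := by
    show ∫ x, (w x ^ 2 + δ ^ 2) ∂vol = _
    rw [integral_add (f := fun x ↦ w x ^ 2) (g := fun _ ↦ δ ^ 2) hw2i (integrable_const _),
      integral_const, smul_eq_mul, mul_comm]
    rfl
  have hNpos : 0 < N := by
    rw [hNeq]; exact add_pos_of_pos_of_nonneg hZ (by positivity)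
  -- the constants `c = log A + log N`, `U = A e^{-c} = 1/N`
  have hc : c = Real.log (A * N) := rfl
  have hcexp : Real.exp (-c) = (A * N)⁻¹ := by
    rw [hc, Real.exp_neg, Real.exp_log (mul_pos hApos hNpos)]
  set U : ℝ := N⁻¹ with hU
  have hUpos : 0 < U := inv_pos.2 hNpos
  have hAU : A * Real.exp (-c) = U := by
    rw [hcexp, mul_inv, ← mul_assoc, mul_inv_cancel₀ hApos.ne', one_mul]
  have hUN : U * N = 1 := inv_mul_cancel₀ hNpos.ne'
  have hcsplit : c = Real.log A + Real.log N := by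
    rw [hc, Real.log_mul hApos.ne' hNpos.ne']
  -- smoothness of `f`
  have hfs : ContMDiff I 𝓘(ℝ, ℝ) ∞ f := by
    intro x
    have hlog : ContDiffAt ℝ ∞ (fun t : ℝ ↦ c - Real.log t) (v x) :=
      contDiffAt_const.sub (Real.contDiffAt_log.2 (hvpos x).ne')
    exact hlog.comp_contMDiffAt (hvs x)
  -- the density `u = A e^{-f} = U v`
  have hdens : ∀ x, entropyDensity n f τ x = U * v x := by
    intro x
    rw [entropyDensity_apply, ← hA, show f x = c - Real.log (v x) from rfl, neg_sub,
      Real.exp_sub, Real.exp_log (hvpos x), div_eq_mul_inv, ← Real.exp_neg]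
    rw [← hAU]; ring
  -- compatibility
  have hcompat : g.IsEntropyCompatible f τ := by
    rw [PseudoRiemannianMetric.isEntropyCompatible_iff]
    simp_rw [← hn, hdens]
    rw [integral_const_mul]
    exact hUN
  refine ⟨hfs, hcompat, ?_⟩
  -- the integrands
  set R : M → ℝ := fun x ↦ g.scalarCurvatureWith cov x with hRdef
  set G : M → ℝ := fun x ↦ 4 * w x ^ 2 * g.gradSq w x / v x with hG
  have hf_eq : f = fun y ↦ c - Real.log (v y) := rfl
  have hgradf : ∀ x, g.gradSq f x = (v x)⁻¹ ^ 2 * (4 * w x ^ 2 * g.gradSq w x) := by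
    intro x
    rw [hf_eq, g.gradSq_const_sub_log_comp c (hvpos x) (hvd x), hv,
      g.gradSq_sq_add_const (δ ^ 2) (hwd x)]
  have hWint : ∀ x, (τ * (R x + g.gradSq f x) + f x - n) * entropyDensity n f τ x =
      U * (τ * (R x * v x) + τ * G x + (c - n) * v x - v x * Real.log (v x)) := by
    intro x
    have hvx : v x ≠ 0 := (hvpos x).ne'
    rw [hdens x, hgradf x, show f x = c - Real.log (v x) from rfl, hG]
    field_simp
    ring
  -- continuity and integrability of the pieces
  have hGc : Continuous G :=
    ((continuous_const.mul (hwc.pow 2)).mul hgradc).div hvc (fun x ↦ (hvpos x).ne')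
  have hlogvc : Continuous (fun x ↦ Real.log (v x)) := hvc.log (fun x ↦ (hvpos x).ne')
  have hRvi : Integrable (fun x ↦ R x * v x) vol := g.integrable_of_continuous (hR.mul hvc)
  have hGi : Integrable G vol := g.integrable_of_continuous hGc
  have hvlogi : Integrable (fun x ↦ v x * Real.log (v x)) vol :=
    g.integrable_of_continuous (hvc.mul hlogvc)
  have hRi : Integrable R vol := g.integrable_of_continuous hR
  have hRwi : Integrable (fun x ↦ R x * w x ^ 2) vol :=
    g.integrable_of_continuous (hR.mul (hwc.pow 2))
  have hgi : Integrable (g.gradSq w) vol := g.integrable_of_continuous hgradc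
  -- `𝒲` as a combination of four integrals
  have hW : g.wEntropy cov f τ = U * (τ * ∫ x, R x * v x ∂vol + τ * ∫ x, G x ∂vol +
      (c - n) * N - ∫ x, v x * Real.log (v x) ∂vol) := by
    rw [PseudoRiemannianMetric.wEntropy_def, ← hn]
    have heq : (fun x ↦ (τ * (g.scalarCurvatureWith cov x + g.gradSq f x) + f x - n) *
        entropyDensity n f τ x) =
        fun x ↦ U * (τ * (R x * v x) + τ * G x + (c - n) * v x - v x * Real.log (v x)) :=
      funext hWint
    rw [heq, integral_const_mul]
    congr 1
    have e3 : ∫ a, (τ * (R a * v a) + τ * G a) ∂vol =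
        τ * ∫ a, R a * v a ∂vol + τ * ∫ a, G a ∂vol := by
      rw [integral_add (hRvi.const_mul τ) (hGi.const_mul τ), integral_const_mul,
        integral_const_mul]
    have e2 : ∫ a, (τ * (R a * v a) + τ * G a + (c - n) * v a) ∂vol =
        (∫ a, (τ * (R a * v a) + τ * G a) ∂vol) + (c - n) * N := by
      rw [integral_add (f := fun a ↦ τ * (R a * v a) + τ * G a) (g := fun a ↦ (c - n) * v a)
        (by exact (hRvi.const_mul τ).add (hGi.const_mul τ)) (hvi.const_mul _), integral_const_mul]
    have e1 : ∫ a, (τ * (R a * v a) + τ * G a + (c - n) * v a - v a * Real.log (v a)) ∂vol =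
        (∫ a, (τ * (R a * v a) + τ * G a + (c - n) * v a) ∂vol) -
          ∫ a, v a * Real.log (v a) ∂vol :=
      integral_sub (f := fun a ↦ τ * (R a * v a) + τ * G a + (c - n) * v a)
        (g := fun a ↦ v a * Real.log (v a))
        (by exact ((hRvi.const_mul τ).add (hGi.const_mul τ)).add (hvi.const_mul _)) hvlogi
    rw [e1, e2, e3]
  -- Term 1: `∫ G ≤ 4 ∫ |∇w|²`
  have hI1 : ∫ x, G x ∂vol ≤ 4 * ∫ x, g.gradSq w x ∂vol := by
    rw [← integral_const_mul]
    refine integral_mono hGi (hgi.const_mul 4) (fun x ↦ ?_)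
    have hGx : G x = 4 * g.gradSq w x * (w x ^ 2 / v x) := by
      simp only [hG]; ring
    have hquot : w x ^ 2 / v x ≤ 1 :=
      div_le_one_of_le₀ (by simp only [hv]; nlinarith [sq_nonneg δ]) (hvpos x).le
    show G x ≤ 4 * g.gradSq w x
    rw [hGx]
    have h4 : 0 ≤ 4 * g.gradSq w x := by linarith [hgrad_nn x]
    calc 4 * g.gradSq w x * (w x ^ 2 / v x) ≤ 4 * g.gradSq w x * 1 := by gcongr
      _ = 4 * g.gradSq w x := mul_one _
  -- Term 2: `∫ R v = ∫ R w² + δ² ∫ R`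
  have hI2 : ∫ x, R x * v x ∂vol = (∫ x, R x * w x ^ 2 ∂vol) + δ ^ 2 * ∫ x, R x ∂vol := by
    rw [← integral_const_mul, ← integral_add hRwi (hRi.const_mul _)]
    refine integral_congr_ae (Eventually.of_forall fun x ↦ ?_)
    simp only [hv]; ring
  -- assemble
  have hWeq : g.wEntropy cov f τ = U * (τ * ∫ x, R x * v x ∂vol + τ * ∫ x, G x ∂vol
      - ∫ x, v x * Real.log (v x) ∂vol) + Real.log N + Real.log A - n
      + (c - n) * (U * N - 1) := by
    rw [hW, hcsplit]; ring
  have hT1 : U * (τ * ∫ x, G x ∂vol) ≤ U * (τ * (4 * ∫ x, g.gradSq w x ∂vol)) := by gcongr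
  rw [hWeq, hUN, sub_self, mul_zero, add_zero, hI2, div_eq_mul_inv]
  have hvlog : ∫ x, v x * Real.log (v x) ∂vol =
      ∫ x, (w x ^ 2 + δ ^ 2) * Real.log (w x ^ 2 + δ ^ 2) ∂vol := rfl
  rw [← hvlog]
  nlinarith [hT1]

/-- **The test-function upper bound for `μ`** (Perelman 2002, (3.1) with
`(4πτ)^{-n/2} e^{-f} = w²/Z`; Topping 2006, (8.1.8)): for `g` Riemannian on a closed manifold
with continuous scalar curvature `R` (w.r.t. `cov`), `τ > 0` and `w` smooth with
`Z = ∫ w² dV > 0`,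
`μ(g, τ) ≤ Z⁻¹ ∫ [τ (R w² + 4 |∇w|²) - w² log w²] dV + log Z + log (4πτ)^{-n/2} - n`.
Proof: `μ ≤ 𝒲(g, f_δ, τ)` for the smooth compatible `f_δ = c_δ - log (w² + δ²)` of
`wEntropy_logTestFunction_le`, and `δ → 0⁺` (the bound is continuous in `δ` at `0`:
parametric integral of the jointly continuous `(δ, x) ↦ (w² + δ²) log (w² + δ²)` over the compact
`M`). [cite: Perelman2002, §3.1, (3.1)] -/
theorem muEntropy_le_testFunction
    {g : PseudoRiemannianMetric I ∞ E (TangentSpace I : M → Type _)} (hg : g.IsRiemannian)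
    {cov : CovariantDerivative I E (TangentSpace I : M → Type _)}
    (hR : Continuous fun x ↦ g.scalarCurvatureWith cov x)
    {τ : ℝ} (hτ : 0 < τ) {w : M → ℝ} (hws : ContMDiff I 𝓘(ℝ, ℝ) ∞ w)
    (hZ : 0 < ∫ x, w x ^ 2 ∂g.riemVolume) :
    g.muEntropy cov τ ≤
      (((∫ x, (τ * (g.scalarCurvatureWith cov x * w x ^ 2 + 4 * g.gradSq w x)
            - w x ^ 2 * Real.log (w x ^ 2)) ∂g.riemVolume) / (∫ x, w x ^ 2 ∂g.riemVolume)
          + Real.log (∫ x, w x ^ 2 ∂g.riemVolume)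
          + Real.log ((4 * Real.pi * τ) ^ (-(finrank ℝ E : ℝ) / 2)) - finrank ℝ E : ℝ) : EReal) := by
  classical
  set vol := g.riemVolume with hvol
  haveI : IsFiniteMeasure vol := ⟨g.riemVolume_univ_lt_top⟩
  set n := finrank ℝ E with hn
  set A : ℝ := (4 * Real.pi * τ) ^ (-(n : ℝ) / 2) with hA
  set VM : ℝ := (vol univ).toReal with hVM
  set Z := ∫ x, w x ^ 2 ∂vol with hZdef
  set IR2 := ∫ x, g.scalarCurvatureWith cov x * w x ^ 2 ∂vol with hIR2
  set IR := ∫ x, g.scalarCurvatureWith cov x ∂vol with hIR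
  set IG := ∫ x, g.gradSq w x ∂vol with hIG
  have hVM0 : 0 ≤ VM := ENNReal.toReal_nonneg
  -- continuity and integrability
  have hwc : Continuous w := hws.continuous
  have hgradc : Continuous (g.gradSq w) :=
    continuous_innerDual_mvfderiv g (hws.of_le (by norm_num)) (hws.of_le (by norm_num))
  have hw2i : Integrable (fun x ↦ w x ^ 2) vol := g.integrable_of_continuous (by fun_prop)
  have hRwi : Integrable (fun x ↦ g.scalarCurvatureWith cov x * w x ^ 2) vol :=
    g.integrable_of_continuous (hR.mul (hwc.pow 2))
  have hgi : Integrable (g.gradSq w) vol := g.integrable_of_continuous hgradc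
  have hwlogi : Integrable (fun x ↦ w x ^ 2 * Real.log (w x ^ 2)) vol :=
    g.integrable_of_continuous (Real.continuous_mul_log.comp (hwc.pow 2))
  have hN : ∀ δ : ℝ, ∫ x, (w x ^ 2 + δ ^ 2) ∂vol = Z + δ ^ 2 * VM := by
    intro δ
    rw [integral_add (f := fun x ↦ w x ^ 2) (g := fun _ ↦ δ ^ 2) hw2i (integrable_const _),
      integral_const, smul_eq_mul, mul_comm]
    rfl
  -- the parametric integral `δ ↦ ∫ (w² + δ²) log (w² + δ²)` is continuous
  have hFLc : Continuous fun δ : ℝ ↦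
      ∫ x, (w x ^ 2 + δ ^ 2) * Real.log (w x ^ 2 + δ ^ 2) ∂vol := by
    have h1 : Continuous fun p : ℝ × M ↦ w p.2 ^ 2 + p.1 ^ 2 := by fun_prop
    have hcts : Continuous (Function.uncurry fun (δ : ℝ) (x : M) ↦
        (w x ^ 2 + δ ^ 2) * Real.log (w x ^ 2 + δ ^ 2)) :=
      Real.continuous_mul_log.comp h1
    have := continuous_parametric_integral_of_continuous (μ := vol) hcts isCompact_univ
    simpa only [Measure.restrict_univ] using this
  -- the bound as a function of `δ`
  set Bnd : ℝ → ℝ := fun δ ↦ (τ * (IR2 + δ ^ 2 * IR) + τ * (4 * IG)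
      - ∫ x, (w x ^ 2 + δ ^ 2) * Real.log (w x ^ 2 + δ ^ 2) ∂vol) / (Z + δ ^ 2 * VM)
    + Real.log (Z + δ ^ 2 * VM) + Real.log A - n with hBnd
  -- Step 1: `μ ≤ Bnd δ` for every `δ > 0`
  have key : ∀ δ : ℝ, 0 < δ → g.muEntropy cov τ ≤ ((Bnd δ : ℝ) : EReal) := by
    intro δ hδ
    obtain ⟨hfs, hcompat, hW⟩ := wEntropy_logTestFunction_le hg hR hτ hws hZ hδ
    refine (PseudoRiemannianMetric.muEntropy_le hfs hcompat).trans ?_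
    rw [EReal.coe_le_coe_iff]
    refine hW.trans (le_of_eq ?_)
    have hN' : ∫ x, (w x ^ 2 + δ ^ 2) ∂g.riemVolume = Z + δ ^ 2 * VM := hN δ
    rw [hN']
  -- Step 2: `Bnd` is continuous at `0`
  have hden : Continuous fun δ : ℝ ↦ Z + δ ^ 2 * VM := by fun_prop
  have hden0 : Z + (0 : ℝ) ^ 2 * VM ≠ 0 := by simpa using hZ.ne'
  have hBc : ContinuousAt Bnd 0 := by
    have hnum : Continuous fun δ : ℝ ↦ τ * (IR2 + δ ^ 2 * IR) + τ * (4 * IG)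
        - ∫ x, (w x ^ 2 + δ ^ 2) * Real.log (w x ^ 2 + δ ^ 2) ∂vol :=
      (by fun_prop : Continuous fun δ : ℝ ↦ τ * (IR2 + δ ^ 2 * IR) + τ * (4 * IG)).sub hFLc
    have h1 : ContinuousAt (fun δ : ℝ ↦ (τ * (IR2 + δ ^ 2 * IR) + τ * (4 * IG)
        - ∫ x, (w x ^ 2 + δ ^ 2) * Real.log (w x ^ 2 + δ ^ 2) ∂vol) / (Z + δ ^ 2 * VM)) 0 :=
      hnum.continuousAt.div hden.continuousAt hden0
    have h2 : ContinuousAt (fun δ : ℝ ↦ Real.log (Z + δ ^ 2 * VM)) 0 :=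
      hden.continuousAt.log hden0
    simp only [hBnd]
    exact ((h1.add h2).add continuousAt_const).sub continuousAt_const
  -- Step 3: the value at `δ = 0`
  have hI : ∫ x, (τ * (g.scalarCurvatureWith cov x * w x ^ 2 + 4 * g.gradSq w x)
      - w x ^ 2 * Real.log (w x ^ 2)) ∂vol =
      τ * (IR2 + (0 : ℝ) ^ 2 * IR) + τ * (4 * IG)
        - ∫ x, (w x ^ 2 + (0 : ℝ) ^ 2) * Real.log (w x ^ 2 + (0 : ℝ) ^ 2) ∂vol := by
    have hA : Integrable (fun x ↦ τ * (g.scalarCurvatureWith cov x * w x ^ 2 + 4 * g.gradSq w x))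
        vol := by
      exact (hRwi.add (hgi.const_mul 4)).const_mul τ
    simp only [ne_eq, OfNat.ofNat_ne_zero, not_false_eq_true, zero_pow, zero_mul, add_zero]
    rw [hIR2, hIG, integral_sub hA hwlogi, integral_const_mul, integral_add hRwi (hgi.const_mul 4),
      integral_const_mul]
    ring
  have hB0 : Bnd 0 = (∫ x, (τ * (g.scalarCurvatureWith cov x * w x ^ 2 + 4 * g.gradSq w x)
      - w x ^ 2 * Real.log (w x ^ 2)) ∂vol) / Z + Real.log Z + Real.log A - n := by
    rw [hI]
    simp only [hBnd]
    simp
  -- Step 4: let `δ → 0⁺`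
  refine EReal.le_of_forall_lt_iff_le.1 (fun z hz ↦ ?_)
  have hz' : Bnd 0 < z := by
    rw [hB0]; exact EReal.coe_lt_coe_iff.1 hz
  have hev : ∀ᶠ δ in 𝓝[>] (0 : ℝ), Bnd δ < z :=
    nhdsWithin_le_nhds (hBc.tendsto.eventually_lt_const hz')
  obtain ⟨δ, h1, hδ⟩ := (hev.and self_mem_nhdsWithin).exists
  exact (key δ hδ).trans (EReal.coe_le_coe_iff.2 h1.le)

end TestFunction

/-- **Test-function bound for Perelman's `μ` on a closed Riemannian `4`-manifold** (registered
stub `stub_muEntropyTestFunction` of line `ancient-sphere-rigidity`; Perelman 2002, (3.1) with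
`φ² = (4πτ)⁻² e^{-f} = w²/Z`; Topping 2006, (8.1.8)): for every smooth `w` with
`Z = ∫ w² dV > 0`,
`μ(g, τ) ≤ Z⁻¹ ∫ [τ (R w² + 4 |∇w|²) - w² log w²] dV + log Z - 2 log (4πτ) - 4`
(`muEntropy_le_testFunction` with `n = 4`, `log (4πτ)^{-2} = -2 log (4πτ)`). [cite: Perelman2002, §3.1, (3.1)] -/
theorem stub_muEntropyTestFunction :
    ∀ (M : Type) [TopologicalSpace M] [T2Space M] [SecondCountableTopology M]
      [ChartedSpace (EuclideanSpace ℝ (Fin 4)) M] [IsManifold (𝓡 4) ∞ M] [CompactSpace M]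
      [T3Space M] [MeasurableSpace M] [BorelSpace M]
      (g : PseudoRiemannianMetric (𝓡 4) ∞ (EuclideanSpace ℝ (Fin 4)) (TangentSpace (𝓡 4) : M → Type _))
      (hg : g.IsRiemannian)
      (cov : CovariantDerivative (𝓡 4) (EuclideanSpace ℝ (Fin 4)) (TangentSpace (𝓡 4) : M → Type _)),
      Continuous (fun x ↦ g.scalarCurvatureWith cov x) →
      ∀ τ : ℝ, 0 < τ → ∀ w : M → ℝ, ContMDiff (𝓡 4) 𝓘(ℝ, ℝ) ∞ w →
      0 < ∫ x, w x ^ 2 ∂g.riemVolume →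
      g.muEntropy cov τ ≤
        (((∫ x, (τ * (g.scalarCurvatureWith cov x * w x ^ 2 + 4 * g.gradSq w x)
              - w x ^ 2 * Real.log (w x ^ 2)) ∂g.riemVolume) / (∫ x, w x ^ 2 ∂g.riemVolume)
            + Real.log (∫ x, w x ^ 2 ∂g.riemVolume) - 2 * Real.log (4 * Real.pi * τ) - 4 : ℝ) : EReal) := by
  intro M _ _ _ _ _ _ _ _ _ g hg cov hR τ hτ w hws hZ
  have h := muEntropy_le_testFunction (I := 𝓡 4) hg hR hτ hws hZ
  have h4 : (finrank ℝ (EuclideanSpace ℝ (Fin 4)) : ℝ) = 4 := by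
    rw [finrank_euclideanSpace_fin]; norm_num
  have hlog : Real.log ((4 * Real.pi * τ) ^ (-(finrank ℝ (EuclideanSpace ℝ (Fin 4)) : ℝ) / 2))
      = -2 * Real.log (4 * Real.pi * τ) := by
    rw [h4, Real.log_rpow (by positivity)]; ring
  rw [hlog, h4] at h
  refine h.trans (le_of_eq ?_)
  congr 1
  ring

end Summit.SmoothPoincare4.SmoothPoincare4.Theorems.SubcylindricalRecognition.AncientSphereRigidity

end
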